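import Summits.CriticalPhenomena.PercolationContinuityZ3.Theorems.PercNearOneGluingNoHeavyLowerTailSunflowerBKStratum
import HarnessLib

/-!
# `NoHeavyLowerTail` (crux stmt-CriticalPhenomena-4575), abstract sunflower cubic: the MEET–JOIN stratum of gen 29 lies inside the
# DISJOINT-OCCURRENCE (BK) stratum of gen 31 — with explicit witnesses `S ∖ ⋂E_j` and `S ∩ ⋂E_j`

Support file (seat `prim-ineq-gen-2` gen 31; `--supports stmt-CriticalPhenomena-4575`; companion of `…SunflowerBKStratum` and `…SunflowerDaykinChain`).
Nothing is asserted about the crux; no `sorry`, no named facts, standard axioms.  Memo: run/shared/lean/prim/prim-ineq-gen-2/BK-STRATUM-GEN31.md §2.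

gen 29 (`…SunflowerDaykinChain.lemmaA_of_meetJoin`) proved Lemma A `μ(E₁)μ(E₂)μ(E₃) ≤ μ(A)²` on the MEET–JOIN stratum `(S ∩ S') ∪ S'' ∈ A`
(`S ∈ E₁`, `S' ∈ E₂`, `S'' ∈ E₃`) by two Ahlswede–Daykin steps; gen 31 (`…SunflowerBKStratum.lemmaA_of_bk`) proved it on the BK stratum
`E_k ⊆ coreShadow E_i A □ coreShadow E_j A` by Harris + van den Berg–Kesten.  The census of the memo (n = 4 exhaustive, n = 5, 6 sampled) found the
first stratum inside the second.  THIS FILE proves it: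

* `inter_sInter_union_mem_of_meetJoin` — under the meet–join condition, for `S ∈ E₁`, `S'' ∈ E₃` and any finite family `F ⊆ E₂`:
  `(S ∩ ⋂F) ∪ S'' ∈ A` (induction on `F`: apply the condition to `X = (S ∩ ⋂F) ∪ S'' ∈ A ⊆ E₁` and `Y = (S ∩ S') ∪ S'' ∈ A ⊆ E₂`).
* `subset_disjointOccurrence_of_meetJoin` — **MEET–JOIN ⟹ BK**: for up-sets `E₁, E₂, E₃` with pairwise intersections `A` and
  `(S ∩ S') ∪ S'' ∈ A` for all `S ∈ E₁, S' ∈ E₂, S'' ∈ E₃`:  `E₁ ⊆ coreShadow E₂ A □ coreShadow E₃ A`, with the witnesses `S ∖ I ∈ coreShadow E₂ A`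
  (a member of `E₂ ∖ A` containing `S ∖ I` would contain `S`, `I ⊆` every member of `E₂`) and `S ∩ I ∈ coreShadow E₃ A` (the lemma with `F = E₂`),
  where `I = ⋂₀ E₂`.  (By the symmetry of the condition in `E₁, E₂` also `E₂ ⊆ coreShadow E₁ A □ coreShadow E₃ A`.)
* `lemmaA_of_meetJoin_via_bk` — gen 29's Lemma A on the stratum, re-derived from `lemmaA_of_bk` (so `…DaykinChain`'s cell rows are instances of
  `…BKStratum`'s).
-/

noncomputable section

namespace Summit.CriticalPhenomena.PercolationContinuityZ3.Theorems.SunflowerPartition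

namespace BKStratum

open MeasureTheory
open Literature.Probability.LatticeModels Literature.Probability.Percolation

variable {ι : Type*}

/-- Under the meet–join condition, intersections of `S ∈ E₁` with finitely many members of `E₂` still join into the core:
`(S ∩ ⋂₀ F) ∪ S'' ∈ A` for every finite `F ⊆ E₂` (for `F = ∅` this reads `S ∪ S'' ∈ A`). [this work] -/
theorem inter_sInter_union_mem_of_meetJoin {E₁ E₂ E₃ A : Set (Set ι)} (h₁ : IsUpperSet E₁) (h₃ : IsUpperSet E₃)
    (hA₁ : A ⊆ E₁) (hA₂ : A ⊆ E₂) (h13 : E₁ ∩ E₃ ⊆ A)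
    (hmj : ∀ S ∈ E₁, ∀ S' ∈ E₂, ∀ S'' ∈ E₃, (S ∩ S') ∪ S'' ∈ A)
    {S S'' : Set ι} (hS : S ∈ E₁) (hS'' : S'' ∈ E₃) (F : Finset (Set ι)) (hF : (↑F : Set (Set ι)) ⊆ E₂) :
    (S ∩ ⋂₀ (↑F : Set (Set ι))) ∪ S'' ∈ A := by
  classical
  induction F using Finset.induction_on with
  | empty =>
    simp only [Finset.coe_empty, Set.sInter_empty, Set.inter_univ]
    exact h13 ⟨h₁ Set.subset_union_left hS, h₃ Set.subset_union_right hS''⟩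
  | insert x F hx ih =>
    have hxE : x ∈ E₂ := hF (by simp)
    have hFE : (↑F : Set (Set ι)) ⊆ E₂ := fun y hy => hF (by simp [Finset.mem_coe.1 hy])
    have hX : (S ∩ ⋂₀ (↑F : Set (Set ι))) ∪ S'' ∈ E₁ := hA₁ (ih hFE)
    have hY : (S ∩ x) ∪ S'' ∈ E₂ := hA₂ (hmj S hS x hxE S'' hS'')
    have key := hmj _ hX _ hY S'' hS''
    have heq : ((S ∩ ⋂₀ (↑F : Set (Set ι))) ∪ S'') ∩ ((S ∩ x) ∪ S'') ∪ S'' =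
        (S ∩ ⋂₀ (↑(insert x F) : Set (Set ι))) ∪ S'' := by
      rw [Finset.coe_insert, Set.sInter_insert]
      ext e
      simp only [Set.mem_union, Set.mem_inter_iff]
      tauto
    rw [heq] at key
    exact key

/-- **MEET–JOIN ⟹ BK.**  For up-sets `E₁, E₂, E₃` of a finite cube with `A ⊆ E₁ ∩ E₂`, `E₁ ∩ E₂ ⊆ A`, `E₁ ∩ E₃ ⊆ A` and the meet–join condition
`(S ∩ S') ∪ S'' ∈ A` (`S ∈ E₁`, `S' ∈ E₂`, `S'' ∈ E₃`), every member `S` of `E₁` witnesses `coreShadow E₂ A` on `S ∖ ⋂₀ E₂` and `coreShadow E₃ A` on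
`S ∩ ⋂₀ E₂`; hence `E₁ ⊆ coreShadow E₂ A □ coreShadow E₃ A`. [this work] -/
theorem subset_disjointOccurrence_of_meetJoin [Fintype ι] {E₁ E₂ E₃ A : Set (Set ι)} (h₁ : IsUpperSet E₁) (h₃ : IsUpperSet E₃)
    (hA₁ : A ⊆ E₁) (hA₂ : A ⊆ E₂) (h12 : E₁ ∩ E₂ ⊆ A) (h13 : E₁ ∩ E₃ ⊆ A)
    (hmj : ∀ S ∈ E₁, ∀ S' ∈ E₂, ∀ S'' ∈ E₃, (S ∩ S') ∪ S'' ∈ A) :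
    E₁ ⊆ coreShadow E₂ A □ coreShadow E₃ A := by
  classical
  intro S hS
  set I : Set ι := ⋂₀ E₂ with hI
  rw [(isUpperSet_coreShadow E₂ A).mem_disjointOccurrence_iff (isUpperSet_coreShadow E₃ A)]
  refine ⟨S \ I, Set.sdiff_subset, S ∩ I, Set.inter_subset_left, ?_, ?_, ?_⟩
  · exact Set.disjoint_left.2 fun e he he' => he.2 he'.2
  · -- `S ∖ I ∈ coreShadow E₂ A`: a member `T ∈ E₂` above `S ∖ I` contains `I`, hence `S`, hence lies in `E₁ ∩ E₂ ⊆ A`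
    intro T hT hTE₂
    have hIT : I ⊆ T := fun e he => Set.mem_sInter.1 he T hTE₂
    have hST : S ⊆ T := fun e he => by
      by_cases heI : e ∈ I
      · exact hIT heI
      · exact hT ⟨he, heI⟩
    exact h12 ⟨h₁ hST hS, hTE₂⟩
  · -- `S ∩ I ∈ coreShadow E₃ A`: by the finite-intersection lemma with `F = E₂`
    rw [mem_coreShadow_iff_union_mem h₃]
    intro S'' hS''
    have hfin : E₂.Finite := Set.toFinite E₂
    have key := inter_sInter_union_mem_of_meetJoin h₁ h₃ hA₁ hA₂ h13 hmj hS hS'' hfin.toFinset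
      (by rw [Set.Finite.coe_toFinset])
    rw [Set.Finite.coe_toFinset] at key
    exact key

/-- gen 29's Lemma A on the meet–join stratum, re-derived through the BK stratum: for a sunflower of up-sets (`E₁ ∩ E₂ = E₁ ∩ E₃ = A`) with
`(S ∩ S') ∪ S'' ∈ A`, `μ(E₂) μ(E₃) μ(E₁) ≤ μ(A)²`, every `p`. [this work] -/
theorem lemmaA_of_meetJoin_via_bk [Fintype ι] (p : ι → unitInterval) {E₁ E₂ E₃ A : Set (Set ι)} (h₁ : IsUpperSet E₁)
    (h₂ : IsUpperSet E₂) (h₃ : IsUpperSet E₃) (h12 : E₁ ∩ E₂ = A) (h13 : E₁ ∩ E₃ = A)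
    (hmj : ∀ S ∈ E₁, ∀ S' ∈ E₂, ∀ S'' ∈ E₃, (S ∩ S') ∪ S'' ∈ A) :
    (prodBernoulli p).real E₂ * (prodBernoulli p).real E₃ * (prodBernoulli p).real E₁ ≤ ((prodBernoulli p).real A) ^ 2 :=
  lemmaA_of_bk p h₂ h₃
    (subset_disjointOccurrence_of_meetJoin h₁ h₃ (h12 ▸ Set.inter_subset_left) (h12 ▸ Set.inter_subset_right) h12.le h13.le hmj)

end BKStratum

end Summit.CriticalPhenomena.PercolationContinuityZ3.Theorems.SunflowerPartition

end
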